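import Summits.QuantumFields.YangMills.Theorems.BalabanLadderUVNonSUNRecEmlAverage
import Literature.MathematicalPhysics.QuantumFieldTheory.Balaban1983to89.BlockAveragingFederbushGValued
import Literature.MathematicalPhysics.QuantumFieldTheory.Balaban1983to89.T4ApexTwoLevel
import HarnessLib

/-!
# Federbush's implicit group average (0.10) for EVERY compact `(G, r)`: the inhabitant of `GroupAverage G`
# (KERNEL PROPERTY #3 of the `(G, r)` averaging prescription of the residual `UVNonSUNRec`)

Route `Summit.QuantumFields.YangMills.Theses.BalabanLadder`, residual `UVOtherGroups` (stmt-QuantumFields-19356) and its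
R85 successor `UVNonSUNRec`.  T. Bałaban, *Renormalization group approach to lattice gauge field theories. I*, Comm. Math.
Phys. **109** (1987) 249–301 (`Balaban1987RG1`), §0 p. 253: the inner average `M({U_j})` of the contour variables (0.11) is
ANY operation with «M({U_j⁻¹}) = M({U_j})⁻¹; (0.5) M({uU_jv}) = uM({U_j})v; (0.6) M(π{U_j}) = M({U_j}) (0.7)», «if U_j ∈ G,
then M({U_j}) ∈ G also. (0.9)», print's own proposal being Federbush's implicit mean «Σ_j (1/i) log U_j U⁻¹ = 0. (0.10)»;
standing assumption pp. 251–252 «G is semisimple and … a Lie subgroup of a group of complex unitary matrices, for example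
G ⊂ U(N)».

THE TREE HAS (0.10) with (0.5)–(0.7) for matrix families (`BlockAveragingFederbush`: `fedM δ`, `fedM_star`, `fedM_conj`
TWO-SIDED, `fedM_perm`, local uniqueness `fedM_unique`), the inhabitants `federbushU : GroupAverage U(N)`,
`federbushSU : GroupAverage SU(N)` ONLY, and (0.9) for every log-charted closed `G` (`BlockAveragingFederbushGValued.fedM_mem_logChart`,
Newton iteration inside the chart).  THIS FILE packages (0.9)–(0.10) into the inhabitant the residual's consumers need:

* §1 the radius `δ_r^F = min(1/100, δ_r/4)` (`δ_r` = the chart radius of `r(G)` of the landed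
  `BalabanLadderUVNonSUNRecEmlAverage`), `star`-closure of `r(G)`, and (0.9): `fedM δ_r^F U ∈ r(G)` for `r(G)`-valued `U`;
* §2 the averaged group element `fedAvg r U := r⁻¹(fedM δ_r^F (r ∘ U)) : G` (faithfulness), `r(fedAvg r U) = fedM δ_r^F (r ∘ U)`;
  the guard in `GaugeGroup.ofUnitaryRep G r` coordinates (`familySmall_rep_iff`); (0.5), (0.6) two-sided, (0.7) by injectivity
  of `r` from the matrix statements; (0.10) under `r`;
* §3 MEASURABILITY at every arity (`r` a closed measurable embedding; `r ∘ fedAvg` is the piecewise of a map continuous on the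
  open guard — `FederbushMean.continuousOn_fedSol` — and the continuous `U ↦ r(U₀)`);
* §4 **`federbushRep r hN : GroupAverage G`** over `GaugeGroup.ofUnitaryRep G r.ρ r.mem_unitary` and the discharge
  `hasFederbushAverage r hN : ∃ 𝓜 : GroupAverage G, 𝓜.MeasurableM ∧ (r ∘ 𝓜.M = fedM on the guard) ∧ (0.10) under r` — for EVERY
  compact group `G` and EVERY faithful unitary lattice representation `r` with `N ≥ 1` (no `SU(N)` hypothesis: Spin, Sp,
  exceptional groups and centre quotients included).

HONEST SCOPE.  Packaging of tree theorems; nothing printed is asserted.  The radius `δ_r^F` depends on `(G, r)` through the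
chart radius of `r(G)` (print: «sufficiently small diameters»); for `SU(N)` in its defining representation the tree's sharper
`federbushSU` (radius `min(1/100, 1/(3N))`) is NOT recovered by this generic construction and is not claimed to be.
-/

namespace Summit.QuantumFields.YangMills.Theorems.UVNonSUNRec

open Literature.MathematicalPhysics.QuantumFieldTheory
open Literature.MathematicalPhysics.QuantumFieldTheory.Balaban1983to89
open FederbushMean (fedM fedSol rel rel_apply fedM_of_small fedM_of_not_small fedM_star fedM_conj fedM_perm fedM_const
  continuousOn_fedSol sum_mlog_mul_star_fedM fedM_mem_logChart)
open MatrixLog (mlog)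
open ExpMeanLog (smallFamilies)
open scoped Matrix Matrix.Norms.L2Operator
open NormedSpace MeasureTheory Set

variable {G : Type} [Group G] [TopologicalSpace G] [CompactSpace G] (r : LatticeRep G)

/-! ## §1 The radius and (0.9) on `r(G)` -/

/-- The Federbush radius of `(G, r)`: `δ_r^F = min(1/100, δ_r/4)`, `δ_r` the chart radius of `r(G)`.
[cite: Balaban1987RG1, (0.9) p.253 («sufficiently small diameters»)] -/
noncomputable def fedRadius : ℝ := min (1 / 100) (emlRadius r / 4)

/-- `0 < δ_r^F`. [folklore] -/
theorem fedRadius_pos : 0 < fedRadius r :=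
  lt_min (by norm_num) (by have := emlRadius_pos r; positivity)

/-- `δ_r^F ≤ 1/100`. [folklore] -/
theorem fedRadius_le : fedRadius r ≤ 1 / 100 := min_le_left _ _

/-- `4 δ_r^F ≤ ρ_{r(G)}` (the chart radius). [folklore] -/
theorem four_mul_fedRadius_le : 4 * fedRadius r ≤ (chart r).ρ := by
  have h := min_le_right (1 / 100 : ℝ) (emlRadius r / 4)
  show 4 * fedRadius r ≤ emlRadius r
  unfold fedRadius
  linarith

omit [CompactSpace G] in
/-- A unitary representation maps inverses to adjoints. [folklore] -/
theorem rho_inv_star (g : G) : r.ρ g⁻¹ = star (r.ρ g) := by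
  have h1 : r.ρ g⁻¹ * r.ρ g = 1 := by rw [← map_mul, inv_mul_cancel, map_one]
  have h2 : r.ρ g * star (r.ρ g) = 1 := Matrix.mem_unitaryGroup_iff.1 (r.mem_unitary g)
  calc r.ρ g⁻¹ = r.ρ g⁻¹ * (r.ρ g * star (r.ρ g)) := by rw [h2, mul_one]
    _ = star (r.ρ g) := by rw [← mul_assoc, h1, one_mul]

/-- `r(G)` (the carrier of the chart) is closed under `star` (= inversion on unitaries). [folklore] -/
theorem star_mem_chart_carrier ⦃g : Matrix (Fin r.N) (Fin r.N) ℂ⦄ (hg : g ∈ (chart r).carrier) :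
    star g ∈ (chart r).carrier := by
  obtain ⟨a, rfl⟩ : g ∈ Set.range r.ρ := hg
  exact ⟨a⁻¹, rho_inv_star r a⟩

/-- **(0.9) FOR `(G, r)`**: the Federbush average of an `r(G)`-valued matrix family at radius `δ_r^F` lies in `r(G)`
(`BlockAveragingFederbushGValued.fedM_mem_logChart` at the chart of `r(G)`). [cite: Balaban1987RG1, (0.9) p.253] -/
theorem fedM_mem_range {m : ℕ} {U : Fin (m + 1) → Matrix (Fin r.N) (Fin r.N) ℂ} (hU : ∀ j, U j ∈ Set.range r.ρ) :
    fedM (fedRadius r) U ∈ Set.range r.ρ :=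
  fedM_mem_logChart (chart r) (star_mem_chart_carrier r) hU (fedRadius_le r) (four_mul_fedRadius_le r)

/-! ## §2 The averaged group element and the axioms (0.5)–(0.7), (0.10) under `r` -/

/-- **Federbush's average of a finite family in `G`**: `r⁻¹(fedM δ_r^F (r ∘ U))` (well defined by (0.9) and faithfulness).
[cite: Balaban1987RG1, (0.10) p.253] -/
noncomputable def fedAvg {m : ℕ} (U : Fin (m + 1) → G) : G :=
  (Set.mem_range.1 (fedM_mem_range r (U := fun j => r.ρ (U j)) (fun j => ⟨U j, rfl⟩))).choose

/-- `r(fedAvg r U) = fedM δ_r^F (r ∘ U)`. [cite: Balaban1987RG1, (0.10) p.253] -/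
theorem rho_fedAvg {m : ℕ} (U : Fin (m + 1) → G) : r.ρ (fedAvg r U) = fedM (fedRadius r) (fun j => r.ρ (U j)) :=
  (Set.mem_range.1 (fedM_mem_range r (U := fun j => r.ρ (U j)) (fun j => ⟨U j, rfl⟩))).choose_spec

variable (hN : 0 < r.N)

omit [CompactSpace G] in
/-- The guard of `GroupAverage` in the coordinates of `GaugeGroup.ofUnitaryRep G r`: `FamilySmall δ U` iff
`‖r(U_i) r(U_k)* − 1‖ < δ` for all `i, k`. [folklore] -/
theorem familySmall_rep_iff {δ : ℝ} {m : ℕ} (U : Fin (m + 1) → G) :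
    haveI : Nonempty (Fin r.N) := ⟨⟨0, hN⟩⟩
    letI : GaugeGroup G := GaugeGroup.ofUnitaryRep G r.ρ r.mem_unitary
    FamilySmall δ U ↔ ∀ i k, ‖r.ρ (U i) * star (r.ρ (U k)) - 1‖ < δ := by
  haveI : Nonempty (Fin r.N) := ⟨⟨0, hN⟩⟩
  letI : GaugeGroup G := GaugeGroup.ofUnitaryRep G r.ρ r.mem_unitary
  refine forall₂_congr fun i k => ?_
  rw [show dist1 (U i * (U k)⁻¹) = ‖r.ρ (U i * (U k)⁻¹) - 1‖ from rfl, map_mul, rho_inv_star]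

/-- **(0.5) for `(G, r)`**: `M({U_j⁻¹}) = M({U_j})⁻¹` on the guard. [cite: Balaban1987RG1, (0.5) p.253] -/
theorem fedAvg_inv {m : ℕ} {U : Fin (m + 1) → G} (h : ∀ i k, ‖r.ρ (U i) * star (r.ρ (U k)) - 1‖ < fedRadius r) :
    fedAvg r (fun j => (U j)⁻¹) = (fedAvg r U)⁻¹ := by
  apply r.injective
  rw [rho_fedAvg, rho_inv_star, rho_fedAvg]
  simp_rw [rho_inv_star]
  exact fedM_star (fun j => r.mem_unitary (U j)) (fedRadius_le r) h

/-- **(0.6), TWO-SIDED, for `(G, r)`**: `M({uU_jv}) = u M({U_j}) v` on the guard. [cite: Balaban1987RG1, (0.6) p.253] -/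
theorem fedAvg_conj {m : ℕ} {U : Fin (m + 1) → G} (h : ∀ i k, ‖r.ρ (U i) * star (r.ρ (U k)) - 1‖ < fedRadius r)
    (u v : G) : fedAvg r (fun j => u * U j * v) = u * fedAvg r U * v := by
  apply r.injective
  rw [rho_fedAvg, map_mul, map_mul, rho_fedAvg]
  simp_rw [map_mul]
  exact fedM_conj (fun j => r.mem_unitary (U j)) (fedRadius_le r) h (r.mem_unitary u) (r.mem_unitary v)

/-- **(0.7) for `(G, r)`**: `M(π{U_j}) = M({U_j})` on the guard. [cite: Balaban1987RG1, (0.7) p.253] -/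
theorem fedAvg_perm {m : ℕ} {U : Fin (m + 1) → G} (h : ∀ i k, ‖r.ρ (U i) * star (r.ρ (U k)) - 1‖ < fedRadius r)
    (σ : Equiv.Perm (Fin (m + 1))) : fedAvg r (U ∘ σ) = fedAvg r U := by
  apply r.injective
  rw [rho_fedAvg, rho_fedAvg]
  exact fedM_perm (fun j => r.mem_unitary (U j)) (fedRadius_le r) h σ

/-- **(0.10) for `(G, r)`**: `Σ_j log(r(U_j) r(M)*) = 0` on the guard — `M = fedAvg r U` solves Federbush's implicit
equation in the representation. [cite: Balaban1987RG1, (0.10) p.253] -/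
theorem sum_mlog_rho_mul_star_fedAvg {m : ℕ} {U : Fin (m + 1) → G}
    (h : ∀ i k, ‖r.ρ (U i) * star (r.ρ (U k)) - 1‖ < fedRadius r) :
    ∑ j, mlog (r.ρ (U j) * star (r.ρ (fedAvg r U))) = 0 := by
  rw [rho_fedAvg]
  exact sum_mlog_mul_star_fedM (fedRadius_le r) h

/-- The average of a constant family is that element. [folklore] -/
theorem fedAvg_const {m : ℕ} (V : G) : fedAvg r (fun _ : Fin (m + 1) => V) = V := by
  apply r.injective
  rw [rho_fedAvg]
  exact fedM_const (fedRadius_pos r) (fedRadius_le r) (r.mem_unitary V)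

/-! ## §3 Measurability at every arity -/

/-- The guard `{U | ∀ i k, ‖r(U_i) r(U_k)* − 1‖ < δ_r^F}` is open. [folklore] -/
theorem isOpen_fedGuard (m : ℕ) :
    IsOpen {U : Fin (m + 1) → G | ∀ i k, ‖r.ρ (U i) * star (r.ρ (U k)) - 1‖ < fedRadius r} := by
  have hco : ∀ i, Continuous fun U : Fin (m + 1) → G => r.ρ (U i) := fun i => r.continuous.comp (continuous_apply i)
  rw [Set.setOf_forall]
  refine isOpen_iInter_of_finite fun i => ?_
  rw [Set.setOf_forall]
  exact isOpen_iInter_of_finite fun k => isOpen_lt (((hco i).mul (hco k).star).sub continuous_const).norm continuous_const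

/-- **MEASURABILITY of `fedAvg r` at every arity** (Borel σ-algebra on `G`). [folklore] -/
theorem measurable_fedAvg [MeasurableSpace G] [BorelSpace G] (m : ℕ) :
    Measurable fun U : Fin (m + 1) → G => fedAvg r U := by
  classical
  letI : MeasurableSpace (Matrix (Fin r.N) (Fin r.N) ℂ) := borel _
  haveI : BorelSpace (Matrix (Fin r.N) (Fin r.N) ℂ) := ⟨rfl⟩
  haveI : SecondCountableTopology G :=
    (r.continuous.isClosedEmbedding r.injective).isEmbedding.secondCountableTopology
  have hEmb : MeasurableEmbedding r.ρ := (r.continuous.isClosedEmbedding r.injective).measurableEmbedding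
  rw [← hEmb.measurable_comp_iff]
  have hco : ∀ i, Continuous fun U : Fin (m + 1) → G => r.ρ (U i) := fun i => r.continuous.comp (continuous_apply i)
  set s : Set (Fin (m + 1) → G) := {U | ∀ i k, ‖r.ρ (U i) * star (r.ρ (U k)) - 1‖ < fedRadius r} with hs
  have hrel : ContinuousOn (fun U : Fin (m + 1) → G => rel (fun j => r.ρ (U j)) 0) s :=
    (continuous_pi fun j => (hco j).mul (hco 0).star).continuousOn
  have hmaps : Set.MapsTo (fun U : Fin (m + 1) → G => rel (fun j => r.ρ (U j)) 0) s
      (smallFamilies (Fin (m + 1)) (Matrix (Fin r.N) (Fin r.N) ℂ) (1 / 100)) :=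
    fun U hU j => (hU j 0).trans_le (fedRadius_le r)
  have hcont : ContinuousOn (fun U : Fin (m + 1) → G => fedM (fedRadius r) (fun j => r.ρ (U j))) s := by
    have h1 : ContinuousOn (fun U : Fin (m + 1) → G =>
        star (fedSol (rel (fun j => r.ρ (U j)) 0)) * r.ρ (U 0)) s :=
      (continuous_star.comp_continuousOn (continuousOn_fedSol.comp hrel hmaps)).mul (hco 0).continuousOn
    exact h1.congr fun U hU => fedM_of_small hU
  have hcont' : ContinuousOn (fun U : Fin (m + 1) → G => fedM (fedRadius r) (fun j => r.ρ (U j))) sᶜ :=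
    (hco 0).continuousOn.congr fun U hU => fedM_of_not_small hU
  have hpw := ContinuousOn.measurable_piecewise hcont hcont' (isOpen_fedGuard r m).measurableSet
  rw [Set.piecewise_same] at hpw
  have heq : (r.ρ ∘ fun U : Fin (m + 1) → G => fedAvg r U) =
      fun U : Fin (m + 1) → G => fedM (fedRadius r) (fun j => r.ρ (U j)) := funext fun U => rho_fedAvg r U
  rw [heq]
  exact hpw

/-! ## §4 The inhabitant of `GroupAverage G` over the structure induced by `r`, and the discharge -/

/-- **FEDERBUSH'S GROUP AVERAGE OF `(G, r)`** as a `GroupAverage G` over `GaugeGroup.ofUnitaryRep G r` (radius `δ_r^F`,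
`M = fedAvg r`, axioms (0.5)–(0.7) from §2). [cite: Balaban1987RG1, (0.5)–(0.7), (0.9)–(0.10) p.253] -/
noncomputable def federbushRep :
    haveI : Nonempty (Fin r.N) := ⟨⟨0, hN⟩⟩
    letI : GaugeGroup G := GaugeGroup.ofUnitaryRep G r.ρ r.mem_unitary
    GroupAverage G := by
  haveI : Nonempty (Fin r.N) := ⟨⟨0, hN⟩⟩
  letI : GaugeGroup G := GaugeGroup.ofUnitaryRep G r.ρ r.mem_unitary
  exact { δ := fedRadius r
          δ_pos := fedRadius_pos r
          M := fun U => fedAvg r U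
          inv := fun U hU => fedAvg_inv r ((familySmall_rep_iff r hN U).1 hU)
          equivariant := fun U hU u v => fedAvg_conj r ((familySmall_rep_iff r hN U).1 hU) u v
          perm := fun U hU σ => fedAvg_perm r ((familySmall_rep_iff r hN U).1 hU) σ }

/-- **KERNEL PROPERTY #3 OF THE `(G, r)` AVERAGING PRESCRIPTION — Federbush's inner mean (0.10) as a measurable
`GroupAverage G`, for EVERY compact group `G` and EVERY faithful unitary lattice representation `r` with `N ≥ 1`**
(no `SU(N)` hypothesis), in the route's structures (`GaugeGroup.ofUnitaryRep`, Borel σ-algebra): there is a group average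
`𝓜` with `𝓜.MeasurableM`, whose image under `r` on its guard IS the tree's matrix Federbush average `fedM 𝓜.δ (r ∘ U)`, and
which solves (0.10) `Σ_j log(r(U_j) r(𝓜.M U)*) = 0` there.  This is the inner-average input of the two-level averaging
(0.11)–(0.12) (`BlockAveragingTwoLevel.contourData 𝓜`, `T4ApexTwoLevel.IsBlockAveraged₂ D 𝓜 ℰ`) for the groups of the residual.
[cite: Balaban1987RG1, (0.5)–(0.7), (0.9)–(0.10) p.253] -/
theorem hasFederbushAverage :
    haveI : Nonempty (Fin r.N) := ⟨⟨0, hN⟩⟩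
    letI : GaugeGroup G := GaugeGroup.ofUnitaryRep G r.ρ r.mem_unitary
    letI : MeasurableSpace G := borel G
    ∃ 𝓜 : GroupAverage G, 𝓜.MeasurableM ∧
      (∀ (m : ℕ) (U : Fin (m + 1) → G), FamilySmall 𝓜.δ U → r.ρ (𝓜.M U) = fedM 𝓜.δ (fun j => r.ρ (U j))) ∧
      ∀ (m : ℕ) (U : Fin (m + 1) → G), FamilySmall 𝓜.δ U → ∑ j, mlog (r.ρ (U j) * star (r.ρ (𝓜.M U))) = 0 := by
  haveI : Nonempty (Fin r.N) := ⟨⟨0, hN⟩⟩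
  letI : GaugeGroup G := GaugeGroup.ofUnitaryRep G r.ρ r.mem_unitary
  letI : MeasurableSpace G := borel G
  haveI : BorelSpace G := ⟨rfl⟩
  exact ⟨federbushRep r hN, fun m => measurable_fedAvg r m, fun m U _ => rho_fedAvg r U,
    fun m U hU => sum_mlog_rho_mul_star_fedAvg r ((familySmall_rep_iff r hN U).1 hU)⟩

/-- The same packaged for the skeleton's binder list (the class hypotheses are not used).
[cite: Balaban1987RG1, (0.5)–(0.7), (0.9)–(0.10) p.253] -/
theorem hasFederbushAverage_all :
    ∀ (G : Type) [Group G] [TopologicalSpace G] [IsTopologicalGroup G] [CompactSpace G],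
      IsCompactSimpleLieGroup G → (∀ N : ℕ, 2 ≤ N → IsEmpty (G ≃ₜ* Matrix.specialUnitaryGroup (Fin N) ℂ)) →
      ∀ (r : LatticeRep G) (hN : 0 < r.N),
        haveI : Nonempty (Fin r.N) := ⟨⟨0, hN⟩⟩
        letI : GaugeGroup G := GaugeGroup.ofUnitaryRep G r.ρ r.mem_unitary
        letI : MeasurableSpace G := borel G
        ∃ 𝓜 : GroupAverage G, 𝓜.MeasurableM ∧
          (∀ (m : ℕ) (U : Fin (m + 1) → G), FamilySmall 𝓜.δ U → r.ρ (𝓜.M U) = fedM 𝓜.δ (fun j => r.ρ (U j))) ∧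
          ∀ (m : ℕ) (U : Fin (m + 1) → G), FamilySmall 𝓜.δ U → ∑ j, mlog (r.ρ (U j) * star (r.ρ (𝓜.M U))) = 0 :=
  fun _ _ _ _ _ _ _ r hN => hasFederbushAverage r hN

end Summit.QuantumFields.YangMills.Theorems.UVNonSUNRec
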